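import Summits.AnomalousDissipation.AnomalousDissipation.Theses.TwoAndHalfD
import Literature.Barriers.AnomalousDissipation.TwoDimensionalEnergyDissipation

/-!
# Sketch — crux idea `log-kantorovich-enstrophy-transfer` for TwohalfdNeg (stmt-AnomalousDissipation-0211)

First-lemma signatures only (nothing proved). See idea-log-kantorovich-enstrophy-transfer.md.
-/

open MeasureTheory Set Filter Topology
open scoped ENNReal NNReal

noncomputable section

namespace Summit.AnomalousDissipation.AnomalousDissipation.Cruxes.TwohalfdNeg.LogKantorovichTransfer

open Literature.Analysis.FunctionSpaces Literature.Analysis.FluidPDE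

/-- The flat two-torus (local notation). -/
local notation "𝕋²" => UnitAddTorus (Fin 2)
/-- Planar vectors (local notation). -/
local notation "E²" => EuclideanSpace ℝ (Fin 2)

/-- **K1-lite (first lemma of the line): windowed logarithmic no-anomaly bound for a RELEASE.**
For normalisation constants of the datum (`a ≤ ‖h‖₁ ≤ b`, `‖∇h‖₁ ≤ B`, `|h| ≤ H`) and a window
length `τ₀` there are `κ₀ ∈ (0,1)` and `C ≥ 0` such that: for every diffusivity `κ ≤ κ₀`, window
`τ ≤ τ₀`, every divergence-free drift `u ∈ L^∞(0,τ; L²)` with time-INTEGRATED strain budget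
`∫₀^τ ‖∇u(t)‖_{L²} dt ≤ S` (spectral `eGradNormSq`), every smooth mean-zero datum `h` so normalised
and every weak solution `θ` of `∂ₜθ + u·∇θ = κΔθ`, `θ(0) = h` on `[0,τ)`:
`κ ∫₀^τ ‖∇θ‖² ≤ C (S + 1) / log(1/κ)` — a release cannot dissipate more than the fraction
`(strain budget)/log(1/κ)` of its variance inside the window (Batchelor time `≳ log(1/κ)/strain`).
Engine: Seis 2022 Lemma 3 (log-Kantorovich distance, in tree: `krLogDist_molRep_level`) applied
per level set + coarea `κ∫‖∇θ‖² = ∫ A(c) dc`; Crippa–De Lellis. Not in print in this form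
(Seis 2022 Thm 2 / Rmk 1 bound exponential RATES; Brué–Nguyen 2021 Thm 1 gives the windowed
form with `log^{-(p-1)}`, `p > 2`, `L^∞_t W^{1,p}`). -/
def ReleaseLogBound : Prop :=
  ∀ (a b B H τ₀ : ℝ), 0 < a → 0 < τ₀ →
    ∃ κ₀ C : ℝ, 0 < κ₀ ∧ κ₀ < 1 ∧ 0 ≤ C ∧
      ∀ (κ τ S : ℝ) (u : ℝ → 𝕋² → E²) (h : 𝕋² → ℝ) (θ : ℝ → 𝕋² → ℝ),
        0 < κ → κ ≤ κ₀ → 0 < τ → τ ≤ τ₀ → 0 ≤ S →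
        (∃ M : ℝ≥0, ∀ᵐ t ∂(volume.restrict (Ioo 0 τ)), ∫⁻ x, ‖u t x‖ₑ ^ 2 ≤ M) →
        ∫⁻ t in Ioo 0 τ, Torus.eGradNormSq (u t) ^ (1 / 2 : ℝ) ≤ ENNReal.ofReal S →
        Torus.IsSmooth h → Torus.HasZeroMean h →
        a ≤ ∫ x, |h x| → ∫ x, |h x| ≤ b → (∀ x, |h x| ≤ H) →
        ∫ x, ‖Torus.gradient h x‖ ≤ B →
        Torus.IsWeakScalarTransportOn τ κ u h θ →
        Torus.eScalarDissipation κ θ 0 τ ≤ ENNReal.ofReal (C * (S + 1) / Real.log κ⁻¹)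

/-- **C⁺ (transfer target, Eulerian `p = 2` form): SUB-LOGARITHMIC MEAN PLANAR STRAIN.**
For every steady smooth divergence-free mean-zero force `g` on `T²` and every vanishing-viscosity
family of global Leray–Hopf solutions with `ν`-uniformly bounded limsup-mean energy, the limsup
long-time mean of `‖∇v_j(t)‖_{L²} = ‖ω_j(t)‖_{L²}` grows slower than `log(1/ν_j)`.
Known: `⟨‖ω_j‖₂²⟩ ≤ C ν_j^{-1/2}` (Alexakis–Doering 2006 §2); Kraichnan–Batchelor predicts
`⟨‖ω‖₂²⟩ ~ χ^{2/3} log^{2/3}(1/ν)`, i.e. the law with margin `log^{2/3}`; single-shell / band-limited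
nonnegative-lower-shell-work forcing: `⟨‖ω‖²⟩ ≤ λ_max E` (Tran–Shepherd pincer, in tree). -/
def SubLogStrain : Prop :=
  ∀ g : 𝕋² → E², Torus.IsSmooth g → Torus.IsDivFree g → Torus.HasZeroMean g →
    ∀ (ν : ℕ → ℝ) (v₀ : ℕ → 𝕋² → E²) (v : ℕ → ℝ → 𝕋² → E²),
      (∀ j, 0 < ν j) → Tendsto ν atTop (𝓝 0) →
      (∀ j, Torus.IsGlobalLerayHopf (ν j) (fun _ => g) (v₀ j) (v j)) →
      (∃ E : ℝ, ∀ j, meanEnergy (v j) ≤ E) →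
      Tendsto (fun j => longTimeAvgSup (fun t => Real.sqrt (Torus.eGradNormSq (v j t)).toReal) /
        Real.log (ν j)⁻¹) atTop (𝓝 0)

/-- **Calibration corollary (the cargo slice `h = c · curl g`): no anomalous ENSTROPHY dissipation at
bounded mean enstrophy, with the logarithmic rate.** For `H¹` data (so that `‖Δv‖²` is locally
integrable in time and `meanEnstrophyDissipation` is honest) and families with `ν`-uniformly bounded
limsup-mean energy and enstrophy, `χ_j = ν_j⟨‖Δv_j‖²⟩ = O(1/log(1/ν_j))`. Would follow from
`ReleaseLogBound` applied to the vorticity as a steadily sourced Pr = 1 scalar (source `curl g`,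
variance `= ⟨‖ω‖²⟩ ≤ W`); Constantin–Ramos 2007 prove the qualitative damped version. -/
def EnstrophyDissipationLogRate : Prop :=
  ∀ g : 𝕋² → E², Torus.IsSmooth g → Torus.IsDivFree g → Torus.HasZeroMean g →
    ∀ (ν : ℕ → ℝ) (v₀ : ℕ → 𝕋² → E²) (v : ℕ → ℝ → 𝕋² → E²),
      (∀ j, 0 < ν j) → Tendsto ν atTop (𝓝 0) →
      (∀ j, MemLp (v₀ j) 2 volume ∧ Torus.eGradNormSq (v₀ j) ≠ ⊤) →
      (∀ j, Torus.IsGlobalLerayHopf (ν j) (fun _ => g) (v₀ j) (v j)) →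
      (∃ E : ℝ, ∀ j, meanEnergy (v j) ≤ E) →
      (∃ W : ℝ, ∀ j, longTimeAvgSup (fun t => (Torus.eGradNormSq (v j t)).toReal) ≤ W) →
      ∃ C : ℝ, ∀ᶠ j in atTop, meanEnstrophyDissipation (ν j) (v j) ≤ C / Real.log (ν j)⁻¹

/-- **Intended composition of the line (shape only, to be cut into stubs at crux-plan):**
windowed release bound + sub-log strain law + the planar Alexakis–Doering bound ⇒ the crux. -/
def LineShape : Prop :=
  ReleaseLogBound → SubLogStrain →
    Literature.Barriers.AnomalousDissipation.AlexakisDoering2006_energyDissipationBound →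
    Summit.AnomalousDissipation.AnomalousDissipation.Theses.TwoAndHalfD.TwohalfdNeg

end Summit.AnomalousDissipation.AnomalousDissipation.Cruxes.TwohalfdNeg.LogKantorovichTransfer

end
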